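import Mathlib
import Summits.NavierStokesRegularity.NavierStokesRegularity.Theorems.TaoLadderRungTwoFlatNearBehindStepSlot
import Summits.NavierStokesRegularity.NavierStokesRegularity.Theorems.TaoLadderRungTwoFlatCoreContractZLanding
import Summits.NavierStokesRegularity.NavierStokesRegularity.Theorems.TaoLadderRungTwoFlatAheadCuts
import Summits.NavierStokesRegularity.NavierStokesRegularity.Theorems.TaoLadderRungTwoFlatHopTubeCanonical
import HarnessLib

/-!
# THE LANDING OBLIGATION `TubeStepLandWith` OF THE SPLIT R54 TUBE AT THE CHOICE RULE, ASSEMBLED (hop `n > N₀`; TRAP #24 cure P-64a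
  by re-instancing, TRAP #25 cure (α) by the co-scaled reference family) — anchor + core (sharp contract + wake row) + near/behind
  (interface loop of record, generic slot) + ahead (cut schedule)
  (helper for the K_A♭ parent item stmt-NavierStokesRegularity-22987 `FlatGapCertificatesV2`, child 2A `GradedAdiabaticWakeA` of
  route TaoLadderRungTwoFlat; cell harvest/h2-tao-ladder, p1 g24; LADDER §50, §59–§64)

The tube is the RE-INSTANCED one of theory-1 g49 (`…CoreContractZ`): schedule `P` in the rôle of the WEAK schedule
(`P := wakeSchedule P₀ aK`, uniform core radius `P.δ = aK = AKD`, true at the wake shell `k = −K`), sharp rows `δs` (`= DCORE`) carried in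
the slot `splitBcl P (behindR54 P θ′ Wb) δs i₀ u⋆ = behindR54 ∧ CoreClauseFrom P δs`. `HopTube.tubeStepLandWith_of_zones` composes:

* ANCHOR — `anchorLower_of_carrier` (bare carrier lower bound at good times) via `tubeStepAnchorWith_of_good`;
* CORE (uniform, weak) — `tubeStepCoreWith_of_split`: the SHARP landing `coreClauseFrom_landing_of_contract` (contract `CoreLandingFromZ` with
  the reference family `W z`, rows `k ≥ 1−K`, ratio floor `AFL := 1 − θ₀ε₀`, row `LandingLevel … ≤ AFL·δs(n+1)` = P-62a) + the WAKE ROW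
  `wakeRow_of_levels` (interface levels at the good time, DISCHARGED by `interfaceLevels_of_schedule_slot`, + reference wake residual `RW` +
  row `hwake`) + `δs(n+1) ≤ P.δ(n+1)`;
* NEAR and BEHIND∧SHARP — `nearBehindR54_landing_of_schedule_slot` (P-61a at good times, generic slot) gives `NearClause` and `behindR54`; the
  slot's second conjunct `CoreClauseFrom (n+1)` is the sharp landing again (`tubeStepBehindWith_of_good` on the split slot);
* AHEAD — `aheadClause_of_schedule` with the initial tail energies DISCHARGED from H(n)'s `AheadClause` + kick (`initialTails_of_premise_slot`).

* `anchorLower_of_carrier`, `interfaceStart_le_of_coreClauseFrom` (the `hsec` producer from the SHARP rows of the split slot),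
  `tubeStepClockWith_of_carrier` (the CLOCK obligation from the same bare carrier bound, `1 + σ ≤ A_*`),
  `initialTails_of_premise_slot`, `tubeStepLandWith_of_schedule_split`.

WHAT REMAINS HYPOTHESIS (by kind). Certificate readouts (ENCLOSURE-SPEC-62 / numT64): `hland : CoreLandingFromZ …` (E2 window rows `k ∈ [1−K, k_A]`
+ (T1) via `coreLandingFromZ_of_window_tail` + `aheadTailWith_of_schedule`), `hwinA : AheadWindowWith …`, `hVt` (window-top bond hull),
`hcore2` (ρ₂ at shell `2−K`, L-61d), `hcarrier` (new-head carrier lower bound at good times), `hRW` (reference-only wake residual). Reference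
family (child 1 + `…CoScaledReference`/`…ScaleCovariance`): `hWflow`, `hM`, `hM₁`, `hM₂`, `hEW` (= 0 under (α)), `hsec`, `hRT`. Section
times: `hex`, `hwin`. Scalar rows: near/behind (`Schedule61.scheduleRowIface_sound`), `hcoreland` (P-62a), `hwake`, `hle` (DCORE ≤ AKD), the cut
schedule (AHEAD-TAIL-62), statics.

HONEST FRAMING: pure composition over the cell's typed induction frame (MODEL lattice, graded mirror table on `S♭`, `m = 2`); nothing is
discharged here beyond bookkeeping; nothing certified; no item closed; nothing about the Navier–Stokes equations.
-/

noncomputable section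

-- the sub-problem namespace repeats the summit name by design (D-0017)
set_option linter.dupNamespace false

namespace Summit.NavierStokesRegularity.NavierStokesRegularity.Theorems.HopTube

open Set Finset Literature.Analysis.FluidPDE Literature.Analysis.FluidPDE.TaoCascade MirrorPulse GappedFrontRobustOn

/-- **Anchor lower band from a bare carrier bound** (clamped ratio of the choice rule): if
`A_*(1−γ)·(1+ε₀)^{−θ₀} ≤ |S i₀ 1 t|` (`γ ≥ 0`) then `A_*(1−γ) ≤ |recentre S t (clampedRatio …) i₀ 0|`.
[cite: Tao2016AveragedNS, §6.4 (statement shape); cell LADDER §50.8 (anchor band), `anchorClause_of_carrier_canonical`] -/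
theorem anchorLower_of_carrier (P : TubeSchedule) (i₀ : Fin 2) {ε₀ : ℝ} (hε₀ : -1 < ε₀) (θ₀ t : ℝ)
    (S : Fin 2 → ℤ → ℝ → ℝ) (hA : 0 < P.Astar) {γ : ℝ} (hγ : 0 ≤ γ)
    (hs : P.Astar * (1 - γ) * (1 + ε₀) ^ (-θ₀) ≤ |S i₀ 1 t|) :
    P.Astar * (1 - γ) ≤ |recentre S t (clampedRatio P i₀ ε₀ θ₀ t S) i₀ 0| := by
  have ha := clampedRatio_pos P i₀ hε₀ θ₀ t S
  simp only [recentre, add_zero]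
  rw [abs_div, abs_of_pos ha, le_div_iff₀ ha]
  rcases le_or_gt (1 - γ) 0 with hγ1 | hγ1
  · have h1 : P.Astar * (1 - γ) ≤ 0 := mul_nonpos_of_nonneg_of_nonpos hA.le hγ1
    have h2 : P.Astar * (1 - γ) * clampedRatio P i₀ ε₀ θ₀ t S ≤ 0 := by nlinarith [h1, ha]
    exact h2.trans (abs_nonneg _)
  · unfold clampedRatio
    rcases max_cases ((1 + ε₀) ^ (-θ₀)) (|S i₀ 1 t| / P.Astar) with ⟨h, _⟩ | ⟨h, _⟩
    · rw [h]; exact hs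
    · rw [h]
      have : P.Astar * (1 - γ) * (|S i₀ 1 t| / P.Astar) = (1 - γ) * |S i₀ 1 t| := by field_simp
      rw [this]
      nlinarith [abs_nonneg (S i₀ 1 t)]

/-- **The section datum at the interface shell from the SHARP rows of the split slot** (`hsec` producer for the re-instanced
tube): kick (`w ≥ 1`), `CoreClauseFrom P δs` at `1−K` (`ω₁ ≤ geomGauge(1−K)`), and the reference start mismatch `E₁` (`= 0` for the
co-scaled family) give `|S₀ᵢ(1−K) − W₀ᵢ(1−K)| ≤ r + δs(n)/ω₁ + E₁`.
[cite: Tao2016AveragedNS, §6.3–6.4 (statement shape); cell LADDER §61 (`hsec`), §64.2 (sharp rows in the split slot)] -/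
theorem interfaceStart_le_of_coreClauseFrom (P : TubeSchedule) {δs : ℕ → ℝ} {i₀ : Fin 2} {ustar z S₀ W₀ : Fin 2 → ℤ → ℝ}
    {n : ℕ} {w : ℤ → ℝ} {r ω₁ E₁ : ℝ} (hcore : CoreClauseFrom P δs i₀ ustar n z)
    (hω₁ : 0 < ω₁) (hω₁le : ∀ i, ω₁ ≤ MirrorPulse.geomGauge P.g P.b i (1 - (P.K : ℤ)))
    (hkick : ∀ i k, w k * |S₀ i k - z i k| ≤ r) (hw1 : ∀ k, 1 ≤ w k)
    (hE₁ : ∀ i, |anchorScale P i₀ z * ustar i (1 - (P.K : ℤ)) - W₀ i (1 - (P.K : ℤ))| ≤ E₁) (i : Fin 2) :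
    |S₀ i (1 - (P.K : ℤ)) - W₀ i (1 - (P.K : ℤ))| ≤ r + δs n / ω₁ + E₁ := by
  have hkick' : |S₀ i (1 - (P.K : ℤ)) - z i (1 - (P.K : ℤ))| ≤ r := by
    calc |S₀ i (1 - (P.K : ℤ)) - z i (1 - (P.K : ℤ))| = 1 * |S₀ i (1 - (P.K : ℤ)) - z i (1 - (P.K : ℤ))| :=
        (one_mul _).symm
      _ ≤ w (1 - (P.K : ℤ)) * |S₀ i (1 - (P.K : ℤ)) - z i (1 - (P.K : ℤ))| :=
        mul_le_mul_of_nonneg_right (hw1 _) (abs_nonneg _)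
      _ ≤ r := hkick i _
  have hc := hcore i (1 - (P.K : ℤ)) le_rfl
  have hdev : |z i (1 - (P.K : ℤ)) - anchorScale P i₀ z * ustar i (1 - (P.K : ℤ))| ≤ δs n / ω₁ := by
    rw [le_div_iff₀ hω₁]
    calc |z i (1 - (P.K : ℤ)) - anchorScale P i₀ z * ustar i (1 - (P.K : ℤ))| * ω₁
        ≤ |z i (1 - (P.K : ℤ)) - anchorScale P i₀ z * ustar i (1 - (P.K : ℤ))|
            * MirrorPulse.geomGauge P.g P.b i (1 - (P.K : ℤ)) :=
          mul_le_mul_of_nonneg_left (hω₁le i) (abs_nonneg _)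
      _ ≤ δs n := by rw [mul_comm]; exact hc
  have e : S₀ i (1 - (P.K : ℤ)) - W₀ i (1 - (P.K : ℤ))
      = (S₀ i (1 - (P.K : ℤ)) - z i (1 - (P.K : ℤ)))
        + (z i (1 - (P.K : ℤ)) - anchorScale P i₀ z * ustar i (1 - (P.K : ℤ)))
        + (anchorScale P i₀ z * ustar i (1 - (P.K : ℤ)) - W₀ i (1 - (P.K : ℤ))) := by ring
  rw [e]
  calc _ ≤ |S₀ i (1 - (P.K : ℤ)) - z i (1 - (P.K : ℤ))
            + (z i (1 - (P.K : ℤ)) - anchorScale P i₀ z * ustar i (1 - (P.K : ℤ)))|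
          + |anchorScale P i₀ z * ustar i (1 - (P.K : ℤ)) - W₀ i (1 - (P.K : ℤ))| := abs_add_le _ _
    _ ≤ (|S₀ i (1 - (P.K : ℤ)) - z i (1 - (P.K : ℤ))|
          + |z i (1 - (P.K : ℤ)) - anchorScale P i₀ z * ustar i (1 - (P.K : ℤ))|)
          + |anchorScale P i₀ z * ustar i (1 - (P.K : ℤ)) - W₀ i (1 - (P.K : ℤ))| := by
        gcongr; exact abs_add_le _ _
    _ ≤ (r + δs n / ω₁) + E₁ := add_le_add (add_le_add hkick' hdev) (hE₁ i)

/-- **CLOCK/RATIO/SLACK obligation from a bare carrier bound** (any slot, choice rule): good section times in `(0, c₀]`, the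
format constant `1 + σ ≤ A_*`, and `(1+σ)·(1+ε₀)^{−θ₀} ≤ |S i₀ 1 t|` at good times give `TubeStepClockWith` (via
`tubeStepClockWith_of_good`; the slack by the clamped-ratio algebra `slack_clampRatio`).
[cite: Tao2016AveragedNS, §6.4 Prop. 6.5 (statement shape); cell TRANSFER-CONSTANTS §4, LADDER §50.7 (B)] -/
theorem tubeStepClockWith_of_carrier (P : TubeSchedule) {Bcl : ℕ → (Fin 2 → ℤ → ℝ) → Prop} {σ ε ε₀ : ℝ} {i₀ : Fin 2}
    {X₀ : Fin 2 → ℝ} {w : ℤ → ℝ} {r θ₀ c₀ t₀ : ℝ} {ζ : ℕ → Fin 2 → ℤ → ℝ} {ustar : Fin 2 → ℤ → ℝ}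
    {good : ℕ → (Fin 2 → ℤ → ℝ → ℝ) → ℝ → Prop} {n : ℕ} (hε₀ : -1 < ε₀) (hσ : 0 ≤ σ) (hσA : 1 + σ ≤ P.Astar)
    (hex : ∀ z S₀ τ S F, HopPremiseWith P Bcl shiftSetFlat ε₀ i₀ (mirrorTable ε ε) X₀ w r c₀ ζ ustar n z S₀ τ S F →
      ∃ t, good n S t)
    (hwin : ∀ z S₀ τ S F, HopPremiseWith P Bcl shiftSetFlat ε₀ i₀ (mirrorTable ε ε) X₀ w r c₀ ζ ustar n z S₀ τ S F →
      ∀ t, good n S t → 0 < t ∧ t ≤ c₀)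
    (hcar : ∀ z S₀ τ S F, HopPremiseWith P Bcl shiftSetFlat ε₀ i₀ (mirrorTable ε ε) X₀ w r c₀ ζ ustar n z S₀ τ S F →
      ∀ t, good n S t → (1 + σ) * (1 + ε₀) ^ (-θ₀) ≤ |S i₀ 1 t|) :
    TubeStepClockWith P Bcl (choiceRule P i₀ ε₀ θ₀ t₀ good) shiftSetFlat σ ε₀ i₀ (mirrorTable ε ε) X₀ w r θ₀ c₀ ζ ustar n :=
  tubeStepClockWith_of_good hε₀ hσ hex hwin fun z S₀ τ S F h t ht =>
    slack_clampRatio (by linarith) (hcar z S₀ τ S F h t ht) hσA (abs_nonneg _)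

section Land

variable {ε ε₀ : ℝ}

/-- **Initial tail energies of a premise** (hop `n > N₀`, any slot): H(n)'s `AheadClause` and the kick ball give, beyond every
`j` with `j + 1 ≥ k₁`, `Σ_{m∈N} Σᵢ S₀(i,m)² ≤ G_j²` for all finite `N ⊆ (j, ∞)`, provided `2·(9r/8)²·Ω_j ≤ G_j²` with `Ω_j` a bound of
the weight tails `Σ_{m∈N} w_m⁻²`. [cite: Tao2016AveragedNS, §6.2 Prop. 6.3 (ix); cell LADDER §62 (AHEAD-TAIL-62, initial tails)] -/
theorem initialTails_of_premise_slot (P : TubeSchedule) {Bcl : ℕ → (Fin 2 → ℤ → ℝ) → Prop} {i₀ : Fin 2} {X₀ : Fin 2 → ℝ}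
    {w : ℤ → ℝ} {r c₀ : ℝ} {ζ : ℕ → Fin 2 → ℤ → ℝ} {ustar : Fin 2 → ℤ → ℝ} {n : ℕ} (hn : P.N₀ < n)
    (hw : ∀ k, 0 < w k) (hr : 0 ≤ r) {kH : ℤ} (hk₁ : (P.k₁ : ℤ) ≤ kH + 2) {Ω G : ℤ → ℝ}
    (hΩ : ∀ j, kH < j → ∀ N : Finset ℤ, (∀ m ∈ N, j < m) → ∑ m ∈ N, (w m)⁻¹ ^ 2 ≤ Ω j)
    (hGΩ : ∀ j, kH < j → 2 * (9 / 8 * r) ^ 2 * Ω j ≤ G j ^ 2) :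
    ∀ j, kH < j → ∀ z S₀ τ S F,
      HopPremiseWith P Bcl shiftSetFlat ε₀ i₀ (mirrorTable ε ε) X₀ w r c₀ ζ ustar n z S₀ τ S F →
        ∀ N : Finset ℤ, (∀ m ∈ N, j < m) → ∑ m ∈ N, ∑ i : Fin 2, S₀ i m ^ 2 ≤ G j ^ 2 := by
  intro j hj z S₀ τ S F hprem N hN
  obtain ⟨hz, hkick, -, -⟩ := hprem
  have h0 : n ≠ 0 := by omega
  have h1 : ¬ n ≤ P.N₀ := by omega
  simp only [InTubeWith, h0, if_false, h1] at hz
  obtain ⟨-, -, -, -, hahead⟩ := hz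
  exact (initialTail_le_of_clauses P hw hr hahead hkick (by omega) hN (hΩ j hj N hN)).trans (hGΩ j hj)

set_option maxHeartbeats 800000 in
/-- **`TubeStepLandWith` OF THE SPLIT R54 TUBE AT THE CHOICE RULE, ASSEMBLED** (hop `n > N₀`; slot
`splitBcl P (behindR54 P θ′ Wb) δs i₀ u⋆`, `P` the weak schedule). See the module docstring for the producers and what remains hypothesis.
[cite: Tao2016AveragedNS, §6.3–6.4 Props. 6.4–6.5 (statement shape of the inductive step); route TaoLadderRungTwoFlat, `HopTube.TubeStepLandWith` for `behindR54` (cell LADDER §50, §59–§62)] -/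
theorem tubeStepLandWith_of_schedule_split (P : TubeSchedule) {θ' : ℝ} {Wb : ℕ → ℝ} {δs : ℕ → ℝ} {i₀ : Fin 2}
    {X₀ : Fin 2 → ℝ} {w : ℤ → ℝ} {r θ₀ c₀ t₀ : ℝ} {ζ : ℕ → Fin 2 → ℤ → ℝ} {ustar : Fin 2 → ℤ → ℝ}
    {good : ℕ → (Fin 2 → ℤ → ℝ → ℝ) → ℝ → Prop} {n : ℕ}
    {cW κ₂ : ℝ} {W₀ FW₀ BW₀ : (Fin 2 → ℤ → ℝ) → Fin 2 → ℤ → ℝ} {W FW : (Fin 2 → ℤ → ℝ) → Fin 2 → ℤ → ℝ → ℝ}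
    -- the co-scaled reference family (one exact flow per tube state `z`, TRAP #25 cure (α)) and statics
    (hWflow : ∀ z, InTubeWith P (splitBcl P (behindR54 P θ' Wb) δs i₀ ustar) i₀ X₀ w r ζ ustar n z →
      PseudoFlowOnShift shiftSetFlat cW ε₀ (mirrorTable ε ε) 0 κ₂ (W₀ z) (FW₀ z) (BW₀ z) (W z) (FW z)) (hcW : c₀ ≤ cW)
    (hε : 0 ≤ ε) (hε₀ : 0 < ε₀) (hn : P.N₀ < n) (hK : 1 ≤ P.K) (hDK : P.K + 1 ≤ P.D) (hθV : 0 < P.θV)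
    (hθ : 0 < θ') (hθ5 : θ' ≤ 5 * Real.log (1 + ε₀)) (hw1 : ∀ k, 1 ≤ w k) (hr0 : 0 ≤ r) (hc₀ : 0 ≤ c₀)
    (hAstar : 0 < P.Astar) (hg : 0 < P.g) (hb : 0 < P.b) {ωK MuK : ℝ} (hωK : 0 < ωK)
    (hωKle : ∀ i, ωK ≤ MirrorPulse.geomGauge P.g P.b i (-(P.K : ℤ))) (hMuK : ∀ i, |ustar i (-(P.K : ℤ))| ≤ MuK)
    (hWbn : 0 ≤ Wb n) (hWbn1 : 0 ≤ Wb (n + 1)) (hvn1 : 0 ≤ P.v (n + 1)) (hδn1 : 0 ≤ P.δ (n + 1))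
    (hγ : 0 ≤ P.γ (n + 1)) (hθ₀ : 0 ≤ θ₀) (hθ₀1 : θ₀ ≤ 1) (hAFL : 0 < 1 - θ₀ * ε₀)
    -- good section times exist and lie in the clock window
    {tlo : ℝ} (htlo : 0 < tlo)
    (hex : ∀ z S₀ τ S F, HopPremiseWith P (splitBcl P (behindR54 P θ' Wb) δs i₀ ustar) shiftSetFlat ε₀ i₀ (mirrorTable ε ε) X₀ w r c₀ ζ
      ustar n z S₀ τ S F → ∃ t, good n S t)
    (hwin : ∀ z S₀ τ S F, HopPremiseWith P (splitBcl P (behindR54 P θ' Wb) δs i₀ ustar) shiftSetFlat ε₀ i₀ (mirrorTable ε ε) X₀ w r c₀ ζ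
      ustar n z S₀ τ S F → ∀ t, good n S t → tlo ≤ t ∧ t ≤ c₀)
    -- ANCHOR: the new-head carrier lower bound at good times
    (hcarrier : ∀ z S₀ τ S F, HopPremiseWith P (splitBcl P (behindR54 P θ' Wb) δs i₀ ustar) shiftSetFlat ε₀ i₀ (mirrorTable ε ε) X₀ w r c₀ ζ
      ustar n z S₀ τ S F → ∀ t, good n S t → P.Astar * (1 - P.γ (n + 1)) * (1 + ε₀) ^ (-θ₀) ≤ |S i₀ 1 t|)
    -- NEAR/BEHIND (interface loop of record): reference data, section datum, deeper core input, interface levels, rows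
    {Aeff A A₀ A₁ M M₁ M₂ rI RBAR BBAR RHO2 rs I₁ I₂ PUMP μN μB VbarN VbarB EW RT V₀N V₀B EN : ℝ}
    (hAeff : 0 < Aeff) (hM0 : 0 ≤ M)
    (hM : ∀ z, InTubeWith P (splitBcl P (behindR54 P θ' Wb) δs i₀ ustar) i₀ X₀ w r ζ ustar n z →
      ∀ s ∈ Icc 0 c₀, ∀ i, ∀ m ∈ Finset.Icc (-(P.D : ℤ)) (1 - (P.K : ℤ)), |W z i m s| ≤ M)
    (hM₁ : ∀ z, InTubeWith P (splitBcl P (behindR54 P θ' Wb) δs i₀ ustar) i₀ X₀ w r ζ ustar n z → ∀ s ∈ Icc 0 c₀, |W z 1 (-(P.K : ℤ)) s| ≤ M₁)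
    (hM₂0 : 0 ≤ M₂)
    (hM₂ : ∀ z, InTubeWith P (splitBcl P (behindR54 P θ' Wb) δs i₀ ustar) i₀ X₀ w r ζ ustar n z → ∀ s ∈ Icc 0 c₀, |W z 0 (2 - (P.K : ℤ)) s| ≤ M₂)
    (hEW : ∀ z, InTubeWith P (splitBcl P (behindR54 P θ' Wb) δs i₀ ustar) i₀ X₀ w r ζ ustar n z →
      coMovingEnergyOn (Finset.Icc (1 - (P.D : ℤ)) (-(P.K : ℤ))) P.θV (-(P.K : ℝ))
        (fun i k _ => anchorScale P i₀ z * ustar i k - W₀ z i k) 0 ≤ EW)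
    (hsec : ∀ z S₀ τ S F, HopPremiseWith P (splitBcl P (behindR54 P θ' Wb) δs i₀ ustar) shiftSetFlat ε₀ i₀ (mirrorTable ε ε) X₀ w r c₀ ζ
      ustar n z S₀ τ S F → ∀ i, |(S - W z) i (1 - (P.K : ℤ)) 0| ≤ rs)
    (hρ0 : 0 ≤ RHO2)
    (hcore2 : ∀ z S₀ τ S F, HopPremiseWith P (splitBcl P (behindR54 P θ' Wb) δs i₀ ustar) shiftSetFlat ε₀ i₀ (mirrorTable ε ε) X₀ w r c₀ ζ
      ustar n z S₀ τ S F → ∀ t, good n S t → ∀ s ∈ Icc 0 t, |(S - W z) 0 (2 - (P.K : ℤ)) s| ≤ RHO2)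
    (hRB0 : 0 ≤ RBAR) (hBB0 : 0 ≤ BBAR) (hRr : RBAR ≤ rI) (hBr : BBAR ≤ rI) (hVN0 : 0 ≤ VbarN)
    (hI₁0 : 0 ≤ I₁) (hI₂0 : 0 ≤ I₂)
    (hI₁ : 2 * (Real.exp (P.θV / 2) - 1) ≤ I₁ * P.θV) (hI₂ : Real.exp P.θV - 1 ≤ I₂ * P.θV)
    (hPUMPdef : PUMP = 1 * c₀ * ((2 + ε) * M * I₁ * Real.sqrt (2 * VbarN) + 2 * I₂ * VbarN))
    (hlevC : rs + PUMP + 1 * c₀ * ((ε * (M + I₁ * Real.sqrt (2 * VbarN)) + ε * M + ε * BBAR) * RBAR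
      + (2 + ε) * M * BBAR + BBAR ^ 2) < RBAR)
    (hlevV : rs + 1 * c₀ * ((M + M₂ + RBAR + RHO2) * BBAR + (1 + 2 * ε) * M * RBAR + ε * RBAR ^ 2
      + (M + 2 * ε * M₂) * RHO2 + ε * RHO2 ^ 2) < BBAR)
    (hRT : ∀ z S₀ τ S F, HopPremiseWith P (splitBcl P (behindR54 P θ' Wb) δs i₀ ustar) shiftSetFlat ε₀ i₀ (mirrorTable ε ε) X₀ w r c₀ ζ
      ustar n z S₀ τ S F → ∀ t, good n S t →
        ∑ k ∈ Finset.Icc (-(P.D : ℤ)) (-(P.K : ℤ) - 1), Real.exp (P.θV * ((k : ℝ) + P.K)) *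
          ∑ i : Fin 2, (W z i (1 + k) t - |S i₀ 1 t| / P.Astar * ustar i k) ^ 2 / 2 ≤ RT)
    (hAdef : A = Real.sqrt (2 * VbarB) * Real.exp (θ' / 2) * Real.exp (θ' * ((P.D : ℝ) - P.K) / 2) + M)
    (hA₀def : A₀ = M + rI) (hA₁def : A₁ = M₁ + Real.sqrt (2 * VbarN) * Real.exp (P.θV / 2))
    (hrA : rI ≤ A) (hA₀le : A₀ ≤ Aeff)
    (hV₀Ndef : V₀N = (Real.sqrt (P.v n + (P.δ n / ωK) ^ 2) + Real.sqrt P.D * r + Real.sqrt EW) ^ 2)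
    (hV₀Bdef : V₀B = (Real.sqrt (Wb n + (MuK + P.δ n / ωK) ^ 2) + r / Real.sqrt (1 - Real.exp (-θ'))) ^ 2)
    (hENdef : EN = Real.exp (P.θV * ((1 : ℝ) - P.D + P.K)) * ((1 + ε) * 1 * A ^ 2 * (A + M))
      + 1 * rI * (2 * VbarN + ε * rI * Real.sqrt (2 * VbarN) + (1 + ε) * M * rI))
    (hμN : 0 < μN)
    (hμNle : μN ≤ (1 / c₀) * P.θV - 2 * (1 + ε) * 1 * (A * Real.sinh (P.θV / 2) + M * (3 + Real.exp P.θV)))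
    (hμB : 0 < μB) (hμBle : μB ≤ (1 / c₀) * θ' - 2 * (1 + ε) * Aeff * Real.sinh (θ' / 2))
    (hlevN : V₀N + EN * c₀ < VbarN) (hlevB : V₀B + A₁ * A₀ * (A₁ + ε * A₀) * c₀ < VbarB)
    (hclose : Real.sqrt (2 * VbarB) * Real.exp (θ' / 2) ≤ Aeff)
    (hbudgetN : ∀ t ∈ Icc tlo c₀, (Real.sqrt (Real.exp (-μN * t) * V₀N + EN * (1 - Real.exp (-μN * t)) / μN)
      + Real.sqrt RT) ^ 2 ≤ (1 - θ₀ * ε₀) ^ 2 * P.v (n + 1))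
    (hbudgetB : ∀ t ∈ Icc tlo c₀, Real.exp (-μB * t) * V₀B + A₁ * A₀ * (A₁ + ε * A₀) * (1 - Real.exp (-μB * t)) / μB
      ≤ (1 - θ₀ * ε₀) ^ 2 * Wb (n + 1))
    -- CORE (sharp rows, P-62a on the sharp schedule `δs`): the landing contract (E2) at the interface levels, reference family
    {lev KF : Fin 2 → ℝ} {RHOC KQ DJ KI RW : ℝ} (hlev0 : RBAR ≤ lev 0) (hlev1 : BBAR ≤ lev 1)
    (hland : CoreLandingFromZ P (splitBcl P (behindR54 P θ' Wb) δs i₀ ustar) shiftSetFlat ε₀ i₀ (mirrorTable ε ε) X₀ w r c₀ ζ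
      ustar good W n lev (LandingLevel RHOC KQ DJ KI (δs n) KF lev))
    (hδs : 0 ≤ δs (n + 1)) (hle : δs (n + 1) ≤ P.δ (n + 1))
    (hcoreland : RHOC * (δs n + KI) + (KF 0 * lev 0 + KF 1 * lev 1) + KQ * (δs n + KI) ^ 2 + DJ
      ≤ (1 - θ₀ * ε₀) * δs (n + 1))
    -- CORE (wake row k = −K on the weak schedule `P.δ = aK`): the reference's own wake residual and the row `hwake`
    (hRW : ∀ z S₀ τ S F, HopPremiseWith P (splitBcl P (behindR54 P θ' Wb) δs i₀ ustar) shiftSetFlat ε₀ i₀ (mirrorTable ε ε)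
      X₀ w r c₀ ζ ustar n z S₀ τ S F → ∀ t, good n S t →
        ∀ i, |W z i (1 - (P.K : ℤ)) t - |S i₀ 1 t| / P.Astar * ustar i (-(P.K : ℤ))| ≤ RW)
    (hwake : ∀ i, geomGauge P.g P.b i (-(P.K : ℤ)) * (lev i + RW) ≤ (1 - θ₀ * ε₀) * P.δ (n + 1))
    -- AHEAD: window rows, window-top hull, cut schedule
    {kH : ℤ} {Vtop : ℝ} {G Ω : ℤ → ℝ} (hk₁ : (P.k₁ : ℤ) ≤ kH + 2) (hVtop : 0 ≤ Vtop) (hG0 : ∀ j, kH < j → 0 ≤ G j)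
    (hwinA : AheadWindowWith P (splitBcl P (behindR54 P θ' Wb) δs i₀ ustar) shiftSetFlat ε₀ i₀ (mirrorTable ε ε) X₀ w r c₀ ζ
      ustar good n kH (1 - θ₀ * ε₀))
    (hVt : ∀ z S₀ τ S F, HopPremiseWith P (splitBcl P (behindR54 P θ' Wb) δs i₀ ustar) shiftSetFlat ε₀ i₀ (mirrorTable ε ε) X₀ w r c₀ ζ
      ustar n z S₀ τ S F → ∀ t ∈ Icc 0 c₀, |S 1 (kH + 1) t| ≤ Vtop)
    (hΩ : ∀ j, kH < j → ∀ N : Finset ℤ, (∀ m ∈ N, j < m) → ∑ m ∈ N, (w m)⁻¹ ^ 2 ≤ Ω j)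
    (hGΩ : ∀ j, kH < j → 2 * (9 / 8 * r) ^ 2 * Ω j ≤ G j ^ 2)
    (hclose0 : 4 / 3 * c₀ * clock ε₀ (kH + 1) * Vtop * (Vtop + 2 * ε * G (kH + 1)) < G (kH + 1))
    (hcloseG : ∀ j, kH + 1 ≤ j →
      4 / 3 * c₀ * clock ε₀ (j + 1) * (2 * G j) * (2 * G j + 2 * ε * G (j + 1)) < G (j + 1))
    (hGr : ∀ k, kH < k → 8 * (w k * (2 * G k)) ≤ r * (1 - θ₀ * ε₀)) :
    TubeStepLandWith P (splitBcl P (behindR54 P θ' Wb) δs i₀ ustar) (choiceRule P i₀ ε₀ θ₀ t₀ good) shiftSetFlat ε₀ i₀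
      (mirrorTable ε ε) X₀ w r c₀ ζ ustar n := by
  have hε₀' : (-1 : ℝ) < ε₀ := by linarith
  have hwin' : ∀ z S₀ τ S F, HopPremiseWith P (splitBcl P (behindR54 P θ' Wb) δs i₀ ustar) shiftSetFlat ε₀ i₀ (mirrorTable ε ε) X₀ w r c₀ ζ
      ustar n z S₀ τ S F → ∀ t, good n S t → 0 < t ∧ t ≤ c₀ := fun z S₀ τ S F h t ht =>
    ⟨htlo.trans_le (hwin z S₀ τ S F h t ht).1, (hwin z S₀ τ S F h t ht).2⟩
  have hgood : ∀ z S₀ τ S F, HopPremiseWith P (splitBcl P (behindR54 P θ' Wb) δs i₀ ustar) shiftSetFlat ε₀ i₀ (mirrorTable ε ε) X₀ w r c₀ ζ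
      ustar n z S₀ τ S F → ∀ t, good n S t → t ∈ Icc 0 c₀ := fun z S₀ τ S F h t ht =>
    ⟨(hwin' z S₀ τ S F h t ht).1.le, (hwin' z S₀ τ S F h t ht).2⟩
  -- the ratio floor of record: `AFL := 1 − θ₀ε₀ ≤ clampedRatio`
  have hratio : ∀ z S₀ τ S F, HopPremiseWith P (splitBcl P (behindR54 P θ' Wb) δs i₀ ustar) shiftSetFlat ε₀ i₀ (mirrorTable ε ε) X₀ w r c₀ ζ
      ustar n z S₀ τ S F → ∀ t, good n S t → 1 - θ₀ * ε₀ ≤ clampedRatio P i₀ ε₀ θ₀ t S :=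
    fun z S₀ τ S F _ t _ => one_sub_mul_le_clampedRatio P i₀ hε₀.le hθ₀ hθ₀1 t S
  have hBcl := splitBcl_fst P (behindR54 P θ' Wb) δs i₀ ustar
  have ht0 : ∀ z S₀ τ S F, HopPremiseWith P (splitBcl P (behindR54 P θ' Wb) δs i₀ ustar) shiftSetFlat ε₀ i₀
      (mirrorTable ε ε) X₀ w r c₀ ζ ustar n z S₀ τ S F → ∀ t, good n S t → 0 ≤ t :=
    fun z S₀ τ S F h t ht => (hwin' z S₀ τ S F h t ht).1.le
  -- ANCHOR
  have hA : TubeStepAnchorWith P (splitBcl P (behindR54 P θ' Wb) δs i₀ ustar) (choiceRule P i₀ ε₀ θ₀ t₀ good) shiftSetFlat ε₀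
      i₀ (mirrorTable ε ε) X₀ w r c₀ ζ ustar n :=
    tubeStepAnchorWith_of_good hε₀' hAstar hex fun z S₀ τ S F h t ht =>
      anchorLower_of_carrier P i₀ hε₀' θ₀ t S hAstar hγ (hcarrier z S₀ τ S F h t ht)
  -- NEAR/BEHIND landing clauses at good times (interface loop of record, generic slot, floor mode)
  have hNB := nearBehindR54_landing_of_schedule_slot (θ₀ := θ₀) P hBcl hWflow hcW hε hε₀ hn hK hDK hθV hθ hθ5 hw1 hr0
    hAstar hωK hωKle hMuK hWbn hWbn1 hvn1 htlo hwin hAFL.le hratio hAeff hM0 hM hM₁ hM₂0 hM₂ hEW hsec hρ0 hcore2 hRB0 hBB0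
    hRr hBr hVN0 hI₁0 hI₂0 hI₁ hI₂ hPUMPdef hlevC hlevV hRT hAdef hA₀def hA₁def hrA hA₀le hV₀Ndef hV₀Bdef hENdef hμN hμNle
    hμB hμBle hlevN hlevB hclose hbudgetN hbudgetB
  have hN : TubeStepNearWith P (splitBcl P (behindR54 P θ' Wb) δs i₀ ustar) (choiceRule P i₀ ε₀ θ₀ t₀ good) shiftSetFlat ε₀ i₀
      (mirrorTable ε ε) X₀ w r c₀ ζ ustar n :=
    tubeStepNearWith_of_good hex fun z S₀ τ S F h t ht => (hNB z S₀ τ S F h t ht).1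
  -- interface levels at good times (discharged) ⇒ the `hlev` input of the sharp contract and of the wake row
  have hlevI := interfaceLevels_of_schedule_slot P hBcl hWflow hcW hε hε₀ hn hK hDK hθV hθ hθ5 hw1 hr0 hAstar hωK hωKle
    hMuK hWbn hwin' hAeff hM0 hM hM₁ hM₂0 hM₂ hEW hsec hρ0 hcore2 hRB0 hBB0 hRr hBr hVN0 hI₁0 hI₂0 hI₁ hI₂ hPUMPdef
    hlevC hlevV hAdef hA₀def hA₁def hrA hA₀le hV₀Ndef hV₀Bdef hENdef hμN hμNle hμB hμBle hlevN hlevB hclose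
  have hlev : ∀ z S₀ τ S F, HopPremiseWith P (splitBcl P (behindR54 P θ' Wb) δs i₀ ustar) shiftSetFlat ε₀ i₀
      (mirrorTable ε ε) X₀ w r c₀ ζ ustar n z S₀ τ S F → ∀ t, good n S t →
        ∀ s ∈ Icc 0 t, ∀ i, |(S - W z) i (1 - (P.K : ℤ)) s| ≤ lev i := by
    intro z S₀ τ S F h t ht s hs i
    obtain ⟨h0, h1⟩ := hlevI z S₀ τ S F h t ht s hs
    fin_cases i
    · exact h0.trans hlev0
    · exact h1.trans hlev1
  -- CORE: sharp landing at good times, wake row, uniform (weak) clause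
  have hfrom := coreClauseFrom_landing_of_contract (θ₀ := θ₀) hland hlev hAFL hratio hδs
    (by simpa [LandingLevel] using hcoreland)
  have hrow := wakeRow_of_levels (θ₀ := θ₀) hg hb hlev ht0 hRW hAFL hratio hδn1 hwake
  have hC : TubeStepCoreWith P (splitBcl P (behindR54 P θ' Wb) δs i₀ ustar) (choiceRule P i₀ ε₀ θ₀ t₀ good) shiftSetFlat ε₀ i₀
      (mirrorTable ε ε) X₀ w r c₀ ζ ustar n :=
    tubeStepCoreWith_of_split hex hfrom hrow hle
  -- BEHIND ∧ SHARP (the split slot at hop n+1)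
  have hB : TubeStepBehindWith P (splitBcl P (behindR54 P θ' Wb) δs i₀ ustar) (choiceRule P i₀ ε₀ θ₀ t₀ good) shiftSetFlat ε₀
      i₀ (mirrorTable ε ε) X₀ w r c₀ ζ ustar n :=
    tubeStepBehindWith_of_good hex fun z S₀ τ S F h t ht => ⟨(hNB z S₀ τ S F h t ht).2, hfrom z S₀ τ S F h t ht⟩
  -- AHEAD (cut schedule; initial tails from H(n))
  have hw0 : ∀ k, 0 < w k := fun k => lt_of_lt_of_le one_pos (hw1 k)
  have hinit := initialTails_of_premise_slot (ε := ε) (ε₀ := ε₀) (Bcl := splitBcl P (behindR54 P θ' Wb) δs i₀ ustar)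
    (i₀ := i₀) (X₀ := X₀) (c₀ := c₀) (ζ := ζ) (ustar := ustar) P hn hw0 hr0 hk₁ hΩ hGΩ
  have hAh : TubeStepAheadWith P (splitBcl P (behindR54 P θ' Wb) δs i₀ ustar) (choiceRule P i₀ ε₀ θ₀ t₀ good) shiftSetFlat ε₀
      i₀ (mirrorTable ε ε) X₀ w r c₀ ζ ustar n :=
    tubeStepAheadWith_of_good hex (aheadClause_of_schedule (a := fun S t => clampedRatio P i₀ ε₀ θ₀ t S) hε hε₀ hc₀
      hr0 (fun k => (hw0 k).le) hAFL hVtop hG0 hwinA hVt hinit hclose0 hcloseG hGr hgood hratio)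
  exact tubeStepLandWith_of_zones P (splitBcl P (behindR54 P θ' Wb) δs i₀ ustar) _ shiftSetFlat ε₀ i₀ (mirrorTable ε ε) X₀ w r
    c₀ ζ ustar hA hC hN hB hAh

end Land

end Summit.NavierStokesRegularity.NavierStokesRegularity.Theorems.HopTube

end
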